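import Mathlib
import HarnessLib

/-!
# WeilTypeLadder · the Gauss block has even length (quadratic reciprocity)

b2b cell `hweil` (packet `run/shared/lean/b2b/hodge-weil/`, report `b2b-hweil-pv3-g51/NORMFORM.md` §4.6 LEMMA E⁺ (c), prover 3
generation 51). PURE ARITHMETIC of Legendre symbols; no geometry, no named fact, no `decide` census.

For distinct odd primes `p`, `q` the report's GAUSS BLOCK `β_{p,q} ⊂ ℤ/pq` is the multiset of the `(p-1)(q-1)/4` units
`CRT(x, y)` (`1 ≤ x ≤ (p-1)/2`, `1 ≤ y ≤ (q-1)/2`) together with the letters `CRT(x, 0)` for `x` in GAUSS'S SET of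
`u = q⁻¹ mod p` (the `x ≤ (p-1)/2` with `u·x mod p > (p-1)/2`, `μ_p` of them) and `CRT(0, y)` for `y` in Gauss's set of
`v = p⁻¹ mod q` (`μ_q` of them). It is an `E`-Weil zero-sum multiset (report 4.6 (a)(b), pen-and-paper), and a cyclic cover
with these rotation numbers needs an EVEN number of branch values: `N = (p-1)(q-1)/4 + μ_p + μ_q`. This file proves that
parity statement from Mathlib's Gauss lemma (`ZMod.gauss_lemma`: `legendreSym p u = (-1)^{μ_p}`) and quadratic reciprocity
(`legendreSym.quadratic_reciprocity`): `(-1)^N = (-1)^{(p/2)(q/2)}·(q/p)·(p/q) = +1`.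

* `legendreSym_eq_of_mul_eq_one` — `a·b ≡ 1 (mod p)` ⟹ `(a/p) = (b/p)` (so `(q⁻¹/p) = (q/p)`);
* `even_gaussBlock_length` — `Even ((p/2)·(q/2) + μ_p(q⁻¹) + μ_q(p⁻¹))` with Gauss's counts written as in `ZMod.gauss_lemma`.

HONEST LABEL: bookkeeping (classical); 0 rungs; nothing of Markman 2025 / Mostaed 2026 / Perry 2026 is used; no kit job.
-/

-- every declaration of this problem lives in `Summit.HodgeConjecture.HodgeConjecture.…` (summit = sub-problem)
set_option linter.dupNamespace false

namespace Summit.HodgeConjecture.HodgeConjecture.WeilTypeLadder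

open Finset

/-- If `a·b ≡ 1 (mod p)` then `a` and `b` have the same Legendre symbol at `p` (their product has symbol `1` and both
symbols are `±1`). [classical] -/
theorem legendreSym_eq_of_mul_eq_one {p : ℕ} [Fact p.Prime] {a b : ℤ}
    (h : (a : ZMod p) * (b : ZMod p) = 1) : legendreSym p a = legendreSym p b := by
  have hb : (b : ZMod p) ≠ 0 := by
    intro hb; rw [hb, mul_zero] at h; exact zero_ne_one h
  have hab : legendreSym p (a * b) = 1 := by
    have hc : ((a * b : ℤ) : ZMod p) = 1 := by push_cast; exact h
    unfold legendreSym
    rw [hc, MulChar.map_one]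
  rw [legendreSym.mul] at hab
  have hb2 : legendreSym p b ^ 2 = 1 := legendreSym.sq_one p hb
  calc legendreSym p a = legendreSym p a * legendreSym p b ^ 2 := by rw [hb2, mul_one]
    _ = (legendreSym p a * legendreSym p b) * legendreSym p b := by ring
    _ = legendreSym p b := by rw [hab, one_mul]

/-- **The Gauss block has even length** (report LEMMA E⁺ (c)): for distinct odd primes `p, q`, with `u ≡ q⁻¹ (mod p)` and
`v ≡ p⁻¹ (mod q)`, the number `(p/2)(q/2) + μ_p(u) + μ_q(v)` is EVEN, where `μ_p(u)` is Gauss's count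
`#{1 ≤ x ≤ p/2 : (u·x mod p) > p/2}` exactly as in `ZMod.gauss_lemma`. Proof: `(-1)^{μ_p(u)} = (u/p) = (q/p)`,
`(-1)^{μ_q(v)} = (p/q)`, and `(q/p)(p/q) = (-1)^{(p/2)(q/2)}`. [classical: Gauss's lemma + quadratic reciprocity] -/
theorem even_gaussBlock_length {p q : ℕ} [Fact p.Prime] [Fact q.Prime] (hp : p ≠ 2) (hq : q ≠ 2) (hpq : p ≠ q)
    {u v : ℤ} (hu : (u : ZMod p) * (q : ZMod p) = 1) (hv : (v : ZMod q) * (p : ZMod q) = 1) :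
    Even (p / 2 * (q / 2) + #{x ∈ Ico 1 (p / 2).succ | p / 2 < (u * x.cast : ZMod p).val}
      + #{y ∈ Ico 1 (q / 2).succ | q / 2 < (v * y.cast : ZMod q).val}) := by
  have hu0 : (u : ZMod p) ≠ 0 := by
    intro h0; rw [h0, zero_mul] at hu; exact zero_ne_one hu
  have hv0 : (v : ZMod q) ≠ 0 := by
    intro h0; rw [h0, zero_mul] at hv; exact zero_ne_one hv
  have hq0 : ((q : ℤ) : ZMod p) ≠ 0 := by
    intro h0; rw [Int.cast_natCast] at h0; rw [h0, mul_zero] at hu; exact zero_ne_one hu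
  have g1 := ZMod.gauss_lemma hp hu0
  have g2 := ZMod.gauss_lemma hq hv0
  have e1 : legendreSym p u = legendreSym p q :=
    legendreSym_eq_of_mul_eq_one (by rw [Int.cast_natCast]; exact hu)
  have e2 : legendreSym q v = legendreSym q p :=
    legendreSym_eq_of_mul_eq_one (by rw [Int.cast_natCast]; exact hv)
  have qr := legendreSym.quadratic_reciprocity hp hq hpq
  have hp0 : ((p : ℤ) : ZMod q) ≠ 0 := by
    intro h0; rw [Int.cast_natCast] at h0; rw [h0, mul_zero] at hv; exact zero_ne_one hv
  have s1 : legendreSym p q ^ 2 = 1 := legendreSym.sq_one p hq0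
  have s2 : legendreSym q p ^ 2 = 1 := legendreSym.sq_one q hp0
  have key : (-1 : ℤ) ^ (p / 2 * (q / 2) + #{x ∈ Ico 1 (p / 2).succ | p / 2 < (u * x.cast : ZMod p).val}
      + #{y ∈ Ico 1 (q / 2).succ | q / 2 < (v * y.cast : ZMod q).val}) = 1 := by
    rw [pow_add, pow_add, ← g1, ← g2, e1, e2, ← qr]
    linear_combination (legendreSym q p) ^ 2 * s1 + s2
  exact (neg_one_pow_eq_one_iff_even (by norm_num)).mp key

end Summit.HodgeConjecture.HodgeConjecture.WeilTypeLadder
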